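import Literature.Probability.LatticeModels.VillainDisorderedModel
import HarnessLib

/-!
# The Messager–Miracle-Solé–Pfister inequality for the Villain interaction

For the Villain model with quenched bond phases `u` on a finite bond system
(`BondSystem.villainWeight`, `VillainDisorderedModel`), quenched phases can only LOWER the
two-point function: `⟨cos(θ(x) − θ(y))⟩_{u,K} ≤ ⟨cos(θ(x) − θ(y))⟩_{1,K}` (`K > 0`) — the Villain
case of Garban–Spencer 2022, Remark 1 / Appendix Thm 7.1 (after Messager–Miracle-Solé–Pfister
1978), which the source covers by Remark 10 ("extends verbatim to the Villain interaction").
PROVED here (`BondSystem.villainExpect_cosDiff_le_villainExpect_one`, character form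
`villainExpect_reChar_le_villainExpect_one`) by the duplication `θ = φψ⁻¹`, `θ' = φψ` of the XY
proof (`MMPInequality`), where the cosine exponent identity is replaced by an exact identity of
theta series:

* `villainKernel_mul_villainKernel_eq_sum` — **the two-term duplication identity**
  `v_K(r + r') v_K(r − r') = ∑_{ε ∈ {0,1}} v_{2K}(r + πε) v_{2K}(r' + πε)` (re-index the product of
  the two theta series by the parity of `n ± n'`, the tree's `hasSum_villainEdge_bound`), and its
  circle form `villainKernel_arg_mul_eq_sum`;
* hence the duplicated product of weights `w_{v²}(φψ) w_1(φψ⁻¹)` is a finite product of two-term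
  sums of rank-one kernels (`villainWeight_dup_eq_prod`), the duplicated integrand
  `2 Im χ₀(φ) Im χ₀(ψ) ∏_a ∑_ε (…)(φ)(…)(ψ)` is a positive kernel (`isPosKernel_villainMMP`, the
  tree's `IsPosKernel` toolkit) and its integral is `≥ 0`.

## References

* C. Garban, T. Spencer, J. Math. Phys. 63 (2022) 093302, arXiv:2109.01617: Remark 1, Remark 10,
  Appendix Theorem 7.1. [GarbanSpencer2022]
* A. Messager, S. Miracle-Solé, C. Pfister, Comm. Math. Phys. 58 (1978) 19–29 (cited through the
  appendix of [GarbanSpencer2022]).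
* J. Ginibre, Comm. Math. Phys. 16 (1970) 310–328 (duplication method). [Ginibre1970]
-/

noncomputable section

namespace Literature.Probability.LatticeModels

open MeasureTheory Finset TopologicalSpace Filter
open scoped BigOperators ComplexConjugate Topology
open Literature.MathematicalPhysics.QuantumFieldTheory

/-! ### Positive kernels: finite products -/

/-- Positive kernels are closed under finite products. [folklore] -/
theorem IsPosKernel.finset_prod {Ω : Type*} [TopologicalSpace Ω] {α : Type*} {s : Finset α}
    {k : α → Ω × Ω → ℝ} (h : ∀ a ∈ s, IsPosKernel (k a)) : IsPosKernel (∏ a ∈ s, k a) := by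
  classical
  induction s using Finset.induction_on with
  | empty =>
    rw [Finset.prod_empty]
    exact isPosKernel_const (Ω := Ω) zero_le_one
  | insert a s has ih =>
    rw [Finset.prod_insert has]
    exact (h a (Finset.mem_insert_self a s)).mul (ih fun b hb => h b (Finset.mem_insert_of_mem hb))

/-! ### The Villain kernel: the two-term duplication identity -/

/-- `v_β(arg e^{it} + c) = v_β(t + c)` (`arg e^{it} ≡ t (mod 2π)` and `v_β` is `2π`-periodic).
[folklore] -/
theorem villainKernel_arg_exp_add (β t c : ℝ) :
    villainKernel β (Complex.arg (Circle.exp t : ℂ) + c) = villainKernel β (t + c) := by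
  rw [Circle.coe_exp, Complex.arg_exp_mul_I, ← self_sub_toIocDiv_zsmul, sub_add_eq_add_sub]
  exact (show Function.Periodic (villainKernel β) (2 * Real.pi) from
    villainKernel_add_two_pi β).sub_zsmul_eq _

/-- `z ↦ v_β(arg z + c)` is continuous on `U(1)` (`β > 0`). [folklore] -/
theorem continuous_villainKernel_arg_add {β : ℝ} (hβ : 0 < β) (c : ℝ) :
    Continuous fun z : Circle => villainKernel β (Complex.arg (z : ℂ) + c) :=
  continuous_comp_arg_of_periodic (g := fun x => villainKernel β (x + c))
    ((continuous_villainKernel hβ).comp (continuous_id.add continuous_const)) fun x => by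
      show villainKernel β (x + 2 * Real.pi + c) = villainKernel β (x + c)
      rw [add_right_comm, villainKernel_add_two_pi]

/-- **The two-term duplication identity of the Villain kernel** (`K > 0`):
`v_K(r + r') v_K(r − r') = ∑_{ε ∈ {0,1}} v_{2K}(r + πε) v_{2K}(r' + πε)`.
Writing both theta series out, `(K/2)[(r+r'+2πn)² + (r−r'+2πn')²] = K(r + π(n+n'))² + K(r' + π(n−n'))²`,
and `(n+n', n−n')` runs over the pairs of integers of equal parity `ε` (the tree's
`hasSum_villainEdge_bound`); summing the even and the odd pairs separately gives the two products of
theta series of stiffness `2K`. This is the Villain substitute for the identity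
`cos θ + cos(θ' − ω) = 2cos(φ − ω/2)cos(φ' − ω/2)` behind the Messager–Miracle-Solé–Pfister
inequality. [folklore] -/
theorem villainKernel_mul_villainKernel_eq_sum {K : ℝ} (hK : 0 < K) (r r' : ℝ) :
    villainKernel K (r + r') * villainKernel K (r - r') =
      ∑ ε : Fin 2, villainKernel (2 * K) (r + Real.pi * ε) * villainKernel (2 * K) (r' + Real.pi * ε) := by
  have h2K : 0 < 2 * K := by positivity
  have hbound := hasSum_villainEdge_bound hK r r'
  -- each parity class sums to a product of two theta series of stiffness `2K`
  have hfib : ∀ ε : Fin 2, HasSum (fun jl : ℤ × ℤ =>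
      Real.exp (-K * (r + Real.pi * (2 * jl.1 + ε.val)) ^ 2) *
        Real.exp (-K * (r' + Real.pi * (2 * jl.2 + ε.val)) ^ 2))
      (villainKernel (2 * K) (r + Real.pi * ε) * villainKernel (2 * K) (r' + Real.pi * ε)) := by
    intro ε
    have hf : HasSum (fun j : ℤ => Real.exp (-K * (r + Real.pi * (2 * j + ε.val)) ^ 2))
        (villainKernel (2 * K) (r + Real.pi * ε)) := by
      have h := (summable_villainKernel_term h2K (r + Real.pi * ε)).hasSum
      refine h.congr_fun fun j => ?_
      congr 1
      ring
    have hg : HasSum (fun l : ℤ => Real.exp (-K * (r' + Real.pi * (2 * l + ε.val)) ^ 2))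
        (villainKernel (2 * K) (r' + Real.pi * ε)) := by
      have h := (summable_villainKernel_term h2K (r' + Real.pi * ε)).hasSum
      refine h.congr_fun fun l => ?_
      congr 1
      ring
    exact hf.mul hg (hf.summable.mul_of_nonneg hg.summable (fun _ => (Real.exp_pos _).le)
      fun _ => (Real.exp_pos _).le)
  have hsum : HasSum (fun ε : Fin 2 =>
      villainKernel (2 * K) (r + Real.pi * ε) * villainKernel (2 * K) (r' + Real.pi * ε))
      (villainKernel K (r + r') * villainKernel K (r - r')) :=
    hbound.prod_fiberwise hfib
  exact (hsum.unique (hasSum_fintype _))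

/-- The two-term identity on the circle: for phases `w, P, Q ∈ U(1)`,
`v_K(arg(w² P Q)) v_K(arg(P Q̄)) = ∑_ε v_{2K}(arg(wP) + πε) v_{2K}(arg(wQ) + πε)`
(the previous identity with `r = arg w + arg P`, `r' = arg w + arg Q`). [folklore] -/
theorem villainKernel_arg_mul_eq_sum {K : ℝ} (hK : 0 < K) (w P Q : Circle) :
    villainKernel K (Complex.arg ((w * w * (P * Q) : Circle) : ℂ)) *
        villainKernel K (Complex.arg ((P * Q⁻¹ : Circle) : ℂ)) =
      ∑ ε : Fin 2, villainKernel (2 * K) (Complex.arg ((w * P : Circle) : ℂ) + Real.pi * ε) *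
        villainKernel (2 * K) (Complex.arg ((w * Q : Circle) : ℂ) + Real.pi * ε) := by
  set α := Complex.arg (P : ℂ)
  set β := Complex.arg (Q : ℂ)
  set γ := Complex.arg (w : ℂ)
  have hP : P = Circle.exp α := (Circle.exp_arg P).symm
  have hQ : Q = Circle.exp β := (Circle.exp_arg Q).symm
  have hw : w = Circle.exp γ := (Circle.exp_arg w).symm
  have h1 : w * w * (P * Q) = Circle.exp ((γ + α) + (γ + β)) := by
    rw [hP, hQ, hw, ← Circle.exp_add, ← Circle.exp_add, ← Circle.exp_add]; congr 1; ring
  have h2 : P * Q⁻¹ = Circle.exp ((γ + α) - (γ + β)) := by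
    rw [hP, hQ, show γ + α - (γ + β) = α - β by ring, Circle.exp_sub, div_eq_mul_inv]
  have h3 : w * P = Circle.exp (γ + α) := by rw [hP, hw, ← Circle.exp_add]
  have h4 : w * Q = Circle.exp (γ + β) := by rw [hQ, hw, ← Circle.exp_add]
  rw [h1, h2, h3, h4]
  have e0 : ∀ t : ℝ, villainKernel K (Complex.arg (Circle.exp t : ℂ)) = villainKernel K t := fun t => by
    simpa using villainKernel_arg_exp_add K t 0
  simp only [e0, villainKernel_arg_exp_add]
  exact villainKernel_mul_villainKernel_eq_sum hK _ _

namespace BondSystem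

variable {V ι : Type*} [Fintype ι] (G : BondSystem V ι)

/-! ### The Messager–Miracle-Solé–Pfister inequality for the Villain interaction -/

/-- **Pull-back of the duplicated product of Villain weights.** With `θ = φψ⁻¹` (pure system),
`θ' = φψ` (phases `u = v²`):
`w_{v²}(φψ) · w_1(φψ⁻¹) = ∏_a ∑_ε v_{2K}(arg(v_a χ_a(φ)) + πε) v_{2K}(arg(v_a χ_a(ψ)) + πε)`.
[cite: GarbanSpencer2022, Appendix, proof of Theorem 7.1, with Remark 10] -/
theorem villainWeight_dup_eq_prod {K : ℝ} (hK : 0 < K) (v : ι → Circle) (φ ψ : V → Circle) :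
    G.villainWeight K (fun a => v a * v a) (φ * ψ) * G.villainWeight K 1 (φ * ψ⁻¹) =
      ∏ a, ∑ ε : Fin 2,
        villainKernel (2 * K) (Complex.arg ((v a * G.bondChar a φ : Circle) : ℂ) + Real.pi * ε) *
          villainKernel (2 * K) (Complex.arg ((v a * G.bondChar a ψ : Circle) : ℂ) + Real.pi * ε) := by
  rw [villainWeight_eq_prod_bondChar, villainWeight_eq_prod_bondChar, ← Finset.prod_mul_distrib]
  refine Finset.prod_congr rfl fun a _ => ?_
  rw [map_mul, map_mul, map_inv, Pi.one_apply, one_mul]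
  exact villainKernel_arg_mul_eq_sum hK (v a) (G.bondChar a φ) (G.bondChar a ψ)

/-- The Villain MMP kernel
`2 Im χ₀(φ) Im χ₀(ψ) ∏_a ∑_ε v_{2K}(arg(v_aχ_a(φ)) + πε) v_{2K}(arg(v_aχ_a(ψ)) + πε)` is a
positive kernel (a finite product of two-term sums of rank-one kernels). [folklore] -/
theorem isPosKernel_villainMMP {K : ℝ} (hK : 0 < K) (v : ι → Circle) (χ₀ : (V → Circle) →ₜ* Circle) :
    IsPosKernel fun p : (V → Circle) × (V → Circle) =>
      2 * (imChar χ₀ p.1 * imChar χ₀ p.2) * ∏ a, ∑ ε : Fin 2,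
        villainKernel (2 * K) (Complex.arg ((v a * G.bondChar a p.1 : Circle) : ℂ) + Real.pi * ε) *
          villainKernel (2 * K) (Complex.arg ((v a * G.bondChar a p.2 : Circle) : ℂ) + Real.pi * ε) := by
  have h2K : 0 < 2 * K := by positivity
  have h1 : IsPosKernel fun p : (V → Circle) × (V → Circle) => 2 * (imChar χ₀ p.1 * imChar χ₀ p.2) :=
    (isPosKernel_mul_self (continuous_imChar χ₀)).const_mul zero_le_two
  -- the edge factors
  set g : ι → Fin 2 → (V → Circle) → ℝ := fun a ε θ =>
    villainKernel (2 * K) (Complex.arg ((v a * G.bondChar a θ : Circle) : ℂ) + Real.pi * ε) with hg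
  have hgc : ∀ a ε, Continuous (g a ε) := fun a ε =>
    (continuous_villainKernel_arg_add h2K (Real.pi * ε)).comp
      (continuous_const.mul (map_continuous (G.bondChar a)))
  have h2 : IsPosKernel fun p : (V → Circle) × (V → Circle) =>
      ∏ a, ∑ ε : Fin 2, g a ε p.1 * g a ε p.2 := by
    have e : (fun p : (V → Circle) × (V → Circle) => ∏ a, ∑ ε : Fin 2, g a ε p.1 * g a ε p.2) =
        ∏ a, ∑ ε : Fin 2, fun p : (V → Circle) × (V → Circle) => g a ε p.1 * g a ε p.2 := by
      funext p
      simp only [Finset.prod_apply, Finset.sum_apply]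
    rw [e]
    exact IsPosKernel.finset_prod fun a _ => IsPosKernel.sum fun ε _ => isPosKernel_mul_self (hgc a ε)
  exact h1.mul h2

variable [Fintype V]

/-- **The Messager–Miracle-Solé–Pfister inequality for the Villain interaction (character form).**
For the Villain model with bond phases `u` on a finite bond system, `K > 0`, and every continuous
unitary character `χ₀` of the torus, `⟨Re χ₀⟩_{u,K} ≤ ⟨Re χ₀⟩_{1,K}`: quenched phases can only
lower the correlations.  Duplication `θ = φψ⁻¹`, `θ' = φψ` as in the XY case
(Garban–Spencer 2022, Appendix Thm. 7.1), with the exponent identity replaced by the two-term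
identity `villainKernel_arg_mul_eq_sum`, which makes the duplicated integrand a positive kernel.
[cite: GarbanSpencer2022, Remark 1, Remark 10 and Appendix Theorem 7.1] -/
theorem villainExpect_reChar_le_villainExpect_one {K : ℝ} (hK : 0 < K) (u : ι → Circle)
    (χ₀ : (V → Circle) →ₜ* Circle) :
    G.villainExpect K u (reChar χ₀) ≤ G.villainExpect K 1 (reChar χ₀) := by
  -- square roots of the phases
  set v : ι → Circle := fun a => Circle.exp (Complex.arg (u a : ℂ) / 2) with hv
  have huv : (fun a => v a * v a) = u := by
    funext a; rw [hv, ← Circle.exp_add, add_halves, Circle.exp_arg]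
  rw [← huv]
  set u' : ι → Circle := fun a => v a * v a
  have hf := continuous_reChar χ₀
  have hw1 := G.continuous_villainWeight hK 1
  have hwu := G.continuous_villainWeight hK u'
  have hZ1 := G.villainPartitionFn_pos hK 1
  have hZu := G.villainPartitionFn_pos hK u'
  unfold villainExpect
  rw [div_le_div_iff₀ hZu hZ1]
  -- the duplicated difference is the integral of the Villain MMP kernel
  have hdup := integral_sub_mul_mul (V := V) hf hw1 hwu
  have hcont : Continuous fun p : (V → Circle) × (V → Circle) =>
      (reChar χ₀ p.2 - reChar χ₀ p.1) * (G.villainWeight K u' p.1 * G.villainWeight K 1 p.2) := by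
    fun_prop
  have hcv := integral_comp_dupHom (torusHaar V) surjective_mul_self_torus hcont
  simp only [dupHom_apply] at hcv
  have hI : ∫ p : (V → Circle) × (V → Circle), (reChar χ₀ (p.1 * p.2⁻¹) - reChar χ₀ (p.1 * p.2)) *
        (G.villainWeight K u' (p.1 * p.2) * G.villainWeight K 1 (p.1 * p.2⁻¹))
        ∂((torusHaar V).prod (torusHaar V)) =
      ∫ p : (V → Circle) × (V → Circle), 2 * (imChar χ₀ p.1 * imChar χ₀ p.2) * ∏ a, ∑ ε : Fin 2,
        villainKernel (2 * K) (Complex.arg ((v a * G.bondChar a p.1 : Circle) : ℂ) + Real.pi * ε) *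
          villainKernel (2 * K) (Complex.arg ((v a * G.bondChar a p.2 : Circle) : ℂ) + Real.pi * ε)
        ∂((torusHaar V).prod (torusHaar V)) := by
    refine integral_congr_ae (ae_of_all _ fun p => ?_)
    dsimp only
    have h1 : reChar χ₀ (p.1 * p.2⁻¹) - reChar χ₀ (p.1 * p.2) = 2 * (imChar χ₀ p.1 * imChar χ₀ p.2) := by
      have := reChar_mul_sub_reChar_mul_inv χ₀ p.1 p.2; linarith
    rw [h1, G.villainWeight_dup_eq_prod hK v p.1 p.2]
  have hpos := (G.isPosKernel_villainMMP hK v χ₀).integral_nonneg (torusHaar V)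
  rw [← hI, hcv, hdup] at hpos
  have : (∫ θ, reChar χ₀ θ * G.villainWeight K u' θ ∂torusHaar V) * G.villainPartitionFn K 1 ≤
      G.villainPartitionFn K u' * ∫ θ, reChar χ₀ θ * G.villainWeight K 1 θ ∂torusHaar V := by
    unfold villainPartitionFn; linarith
  linarith [this]

/-- **MMP for the Villain interaction (Garban–Spencer 2022, Remark 1 with Remark 10):**
`⟨cos(θ(x) − θ(y))⟩_{ω,K} ≤ ⟨cos(θ(x) − θ(y))⟩_{ω=0,K}` for every choice of bond phases.
[cite: GarbanSpencer2022, Remark 1, Remark 10 and Appendix Theorem 7.1] -/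
theorem villainExpect_cosDiff_le_villainExpect_one {K : ℝ} (hK : 0 < K) (u : ι → Circle) (x y : V) :
    G.villainExpect K u (cosDiff x y) ≤ G.villainExpect K 1 (cosDiff x y) := by
  have h := G.villainExpect_reChar_le_villainExpect_one hK u (diffChar x y)
  have e : (cosDiff x y : (V → Circle) → ℝ) = reChar (diffChar x y) :=
    funext fun θ => cosDiff_eq_reChar x y θ
  rwa [← e] at h

end BondSystem

end Literature.Probability.LatticeModels
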